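import Summits.KontsevichZagierPeriods.KontsevichZagierPeriods.Theorems.FurushoPentagonSectorToKernelStokesSpanCalibration
import Literature.NumberTheory.Transcendental.KZMellinFibres
import Literature.NumberTheory.Transcendental.KZSemiCanonicalReductionProofs
import Literature.NumberTheory.Transcendental.NashCubes
import Literature.NumberTheory.Transcendental.SemialgebraicVolume
import Mathlib.Analysis.Analytic.Constructions
import Mathlib.Analysis.Analytic.Linear

/-!
# `SectorToKernel` (stmt-KontsevichZagierPeriods-10813), line `effective-cube-surjection`:
# after the power substitution, an open-cube class is a tame cube class (all dimensions)

Towards the remaining theorem-grade stub G = `stub_openCubeNashResolution` (= the second registered stub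
of item stmt-KontsevichZagierPeriods-17978): its last, dimension-free step as Kontsevich–Zagier MOVES.
If `w = [(0,1)ᵐ, f]` and the substituted integrand `x ↦ f(x₁ᴺ, …, xₘᴺ) · ∏ N xᵢᴺ⁻¹` is the restriction to
the open cube of a function `H` analytic on a neighbourhood of the CLOSED cube, then `[w]` is congruent
modulo relations to the tame cube class `[[0,1]ᵐ, H]`: the power substitution is a chain of `m` box
dilations `xⱼ ↦ xⱼᴺ` (rule (2), `KZ.of_sub_of_mem_relations_of_boxDilation`, one coordinate at a time,
the intermediate representations being pulled back along `MeasureTheory.integrableOn_image_iff…`), the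
boundary of the cube is null (rule (1a)), and `H` is `ℚ`-semialgebraic on the closed cube by continuity
(`stokesCal_isSemialgebraicFunOn_of_subset_closure`).  This is the `m`-dimensional analogue of the landed
one-variable rung `stub_pieceToTameCube`.
[Kontsevich–Zagier 2001, §1.2 rules (1), (2); Huber–Müller-Stach 2017, Lemma 12.2.2]
-/

noncomputable section

namespace Summit.KontsevichZagierPeriods.FurushoPentagon.SectorToKernel

open Set MeasureTheory Filter Topology
open Literature.ModelTheory.ExponentialFields
open Literature.NumberTheory.Transcendental
open Literature.NumberTheory.Transcendental.KZ

/-! ## Box dilations of the open cube -/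

/-- A box dilation maps the open unit cube ONTO itself. [cite: KontsevichZagier2001, §1.2 rule (2)] -/
theorem image_boxDilation_openCube {m : ℕ} (j : Fin m) (k : ℕ) :
    boxDilation j k '' {x : Fin m → ℝ | ∀ i, 0 < x i ∧ x i < 1} = {x : Fin m → ℝ | ∀ i, 0 < x i ∧ x i < 1} := by
  classical
  ext y
  constructor
  · rintro ⟨x, hx, rfl⟩
    exact fun i => boxDilation_mem_box (fun i => hx i) i
  · intro hy
    refine ⟨fun i => if i = j then y j ^ ((1 : ℝ) / (k + 1)) else y i, fun i => ?_, ?_⟩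
    · by_cases h : i = j
      · subst h
        simp only [if_true]
        exact ⟨Real.rpow_pos_of_pos (hy i).1 _,
          Real.rpow_lt_one (hy i).1.le (hy i).2 (by positivity)⟩
      · simp only [if_neg h]; exact hy i
    · funext i
      by_cases h : i = j
      · subst h
        rw [boxDilation_apply_self, if_pos rfl, ← Real.rpow_natCast,
          ← Real.rpow_mul (hy i).1.le]
        have : (1 : ℝ) / (k + 1) * ((k + 1 : ℕ) : ℝ) = 1 := by
          rw [Nat.cast_add_one]; field_simp
        rw [this, Real.rpow_one]
      · rw [boxDilation_apply_of_ne k h, if_neg h]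

/-- The open unit cube is `ℚ`-semialgebraic (set-builder form). [folklore] -/
theorem isSemialgebraic_openCube' (m : ℕ) : IsSemialgebraic ℚ {x : Fin m → ℝ | ∀ i, 0 < x i ∧ x i < 1} :=
  Literature.NumberTheory.Transcendental.isSemialgebraic_openUnitCube

/-- The open unit cube is open (set-builder form). [folklore] -/
theorem isOpen_openCube' (m : ℕ) : IsOpen {x : Fin m → ℝ | ∀ i, 0 < x i ∧ x i < 1} :=
  Literature.NumberTheory.Transcendental.isOpen_openUnitCube

/-- **One box dilation, with the pulled-back representation constructed.**  For a representation `w` on the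
open cube and a coordinate `j`, there is a representation `w'` on the open cube with integrand
`x ↦ w (x with xⱼ ↦ xⱼᵏ⁺¹) · (k+1) xⱼᵏ` and `[w'] − [w] ∈ relations`. [cite: KontsevichZagier2001, §1.2 rule (2)] -/
theorem exists_boxDilation_pullback {m : ℕ} (j : Fin m) (k : ℕ) (w : IntegralRep m)
    (hw : w.domain = {x : Fin m → ℝ | ∀ i, 0 < x i ∧ x i < 1}) :
    ∃ w' : IntegralRep m, w'.domain = {x : Fin m → ℝ | ∀ i, 0 < x i ∧ x i < 1} ∧
      (w'.integrand = fun x => w.integrand (boxDilation j k x) * ((k + 1 : ℕ) * x j ^ k)) ∧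
      of w' - of w ∈ relations := by
  obtain ⟨C, hC⟩ : ∃ C : Set (Fin m → ℝ), C = {x : Fin m → ℝ | ∀ i, 0 < x i ∧ x i < 1} := ⟨_, rfl⟩
  rw [← hC] at hw ⊢
  have hCs : IsSemialgebraic ℚ C := hC ▸ isSemialgebraic_openCube' m
  have hpos : ∀ x ∈ C, 0 < x j := fun x hx => by rw [hC] at hx; exact (hx j).1
  have himg : boxDilation j k '' C = C := by rw [hC, image_boxDilation_openCube]
  have hmaps : MapsTo (boxDilation j k) C C := fun x hx => by
    rw [← himg]; exact mem_image_of_mem _ hx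
  -- semialgebraicity of the pulled-back integrand
  have hΦ : IsSemialgebraicMapOn ℚ C (boxDilation j k) := by
    convert isSemialgebraicMapOn_aeval hCs (dilateSubst j k) using 2 with z
    exact (aeval_dilateSubst_eq j k z).symm
  have hsa : IsSemialgebraicFunOn ℚ C (fun x => w.integrand (boxDilation j k x) * ((k + 1 : ℕ) * x j ^ k)) := by
    have h1 : IsSemialgebraicFunOn ℚ C (fun x => w.integrand (boxDilation j k x)) :=
      IsSemialgebraicFunOn.comp_isSemialgebraicMapOn_holds (hw ▸ w.isSemialgebraicFunOn_integrand) hΦ hmaps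
    have h2 : IsSemialgebraicFunOn ℚ C (fun x : Fin m → ℝ => ((k + 1 : ℕ) : ℝ) * x j ^ k) := by
      convert isSemialgebraicFunOn_aeval hCs
        (MvPolynomial.C ((k + 1 : ℕ) : ℚ) * MvPolynomial.X j ^ k : MvPolynomial (Fin m) ℚ) using 2 with x
      simp
    exact IsSemialgebraicFunOn.mul_holds h1 h2
  -- integrability by the Jacobian formula
  obtain ⟨L, hdet, hL⟩ := exists_hasFDerivAt_boxDilation j k
  have hint : IntegrableOn (fun x => w.integrand (boxDilation j k x) * ((k + 1 : ℕ) * x j ^ k)) C := by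
    have key := (integrableOn_image_iff_integrableOn_abs_det_fderiv_smul volume
      (IsSemialgebraic.measurableSet_holds hCs) (fun x _ => (hL x).hasFDerivWithinAt)
      (injOn_boxDilation j k hpos) w.integrand).1 (by rw [himg, ← hw]; exact w.integrableOn)
    refine key.congr_fun (fun x hx => ?_) (IsSemialgebraic.measurableSet_holds hCs)
    dsimp only
    rw [hdet, smul_eq_mul, abs_of_pos (by have := hpos x hx; positivity), mul_comm]
  refine ⟨⟨C, fun x => w.integrand (boxDilation j k x) * ((k + 1 : ℕ) * x j ^ k), hCs, hsa, hint⟩,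
    rfl, rfl, ?_⟩
  exact of_sub_of_mem_relations_of_boxDilation j k (fun x hx => hpos x hx)
    (by rw [hw]; exact himg.symm) (fun x _ => rfl)

/-- **The power substitution in a set of coordinates**, by iterated box dilations: for every finite set `S`
of coordinates there is a representation on the open cube with integrand
`x ↦ w(xᵢᴺ for i ∈ S, xᵢ otherwise) · ∏_{i ∈ S} N xᵢᴺ⁻¹`, congruent to `w` modulo relations.
[cite: KontsevichZagier2001, §1.2 rule (2)] -/
theorem exists_powerSubst {m : ℕ} (N : ℕ) (hN : 0 < N) (w : IntegralRep m)
    (hw : w.domain = {x : Fin m → ℝ | ∀ i, 0 < x i ∧ x i < 1}) (S : Finset (Fin m)) :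
    ∃ wS : IntegralRep m, wS.domain = {x : Fin m → ℝ | ∀ i, 0 < x i ∧ x i < 1} ∧
      (∀ x ∈ {x : Fin m → ℝ | ∀ i, 0 < x i ∧ x i < 1},
        wS.integrand x = w.integrand (fun i => if i ∈ S then x i ^ N else x i) *
          ∏ i ∈ S, ((N : ℝ) * x i ^ (N - 1))) ∧
      of w - of wS ∈ relations := by
  classical
  induction S using Finset.induction_on with
  | empty =>
    refine ⟨w, hw, fun x _ => ?_, by simp⟩
    simp
  | insert j S hj ih =>
    obtain ⟨wS, hwSd, hwSi, hwS⟩ := ih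
    obtain ⟨w', hw'd, hw'i, hw'⟩ := exists_boxDilation_pullback j (N - 1) wS hwSd
    have hN1 : N - 1 + 1 = N := Nat.sub_add_cancel hN
    refine ⟨w', hw'd, fun x hx => ?_, ?_⟩
    · have hbx : boxDilation j (N - 1) x ∈ {x : Fin m → ℝ | ∀ i, 0 < x i ∧ x i < 1} :=
        fun i => boxDilation_mem_box (fun i => hx i) i
      rw [hw'i]
      simp only
      rw [hwSi _ hbx, Finset.prod_insert hj, hN1]
      have h1 : (fun i => if i ∈ S then boxDilation j (N - 1) x i ^ N else boxDilation j (N - 1) x i) =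
          fun i => if i ∈ insert j S then x i ^ N else x i := by
        funext i
        by_cases hij : i = j
        · subst hij
          rw [if_neg hj, if_pos (Finset.mem_insert_self _ _), boxDilation_apply_self, hN1]
        · rw [boxDilation_apply_of_ne _ hij]
          simp [Finset.mem_insert, hij]
      have h2 : ∏ i ∈ S, ((N : ℝ) * boxDilation j (N - 1) x i ^ (N - 1)) = ∏ i ∈ S, ((N : ℝ) * x i ^ (N - 1)) := by
        refine Finset.prod_congr rfl fun i hi => ?_
        rw [boxDilation_apply_of_ne _ (fun h => by subst h; exact hj hi)]
      rw [h1, h2]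
      ring
    · have : of w - of w' = (of w - of wS) - (of w' - of wS) := by abel
      rw [this]
      exact relations.sub_mem hwS hw'

/-! ## The closed cube -/

/-- The closed cube lies in the closure of the open cube. [folklore] -/
theorem cube_subset_closure_openCube (m : ℕ) :
    KZ.cube m ⊆ closure {x : Fin m → ℝ | ∀ i, 0 < x i ∧ x i < 1} := by
  have h1 : {x : Fin m → ℝ | ∀ i, 0 < x i ∧ x i < 1} = Set.pi univ fun _ => Ioo (0:ℝ) 1 := by
    ext x; simp
  rw [h1, closure_pi_set, KZ.cube_eq_Icc, ← Set.pi_univ_Icc]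
  refine Set.pi_mono fun i _ => ?_
  rw [closure_Ioo zero_ne_one]
  exact Subset.rfl

/-- The closed cube exceeds the open cube by a null set. [folklore] -/
theorem volume_cube_diff_openCube (m : ℕ) :
    volume (KZ.cube m \ {x : Fin m → ℝ | ∀ i, 0 < x i ∧ x i < 1}) = 0 := by
  have hsub : KZ.cube m \ {x : Fin m → ℝ | ∀ i, 0 < x i ∧ x i < 1} ⊆
      frontier {x : Fin m → ℝ | ∀ i, 0 < x i ∧ x i < 1} := by
    intro x hx
    rw [frontier, (isOpen_openCube' m).interior_eq]
    exact ⟨cube_subset_closure_openCube m hx.1, hx.2⟩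
  exact measure_mono_null hsub (volume_frontier_eq_zero_of_isSemialgebraic (isSemialgebraic_openCube' m))

/-! ## The theorem -/

/-- **After the power substitution an open-cube class is a tame cube class.**  Let `w = [(0,1)ᵐ, f]` and
`0 < N`; if `H` is analytic on a neighbourhood of the closed cube `[0,1]ᵐ` and
`H x = f (x₁ᴺ, …, xₘᴺ) · ∏ᵢ N xᵢᴺ⁻¹` on the open cube, then `[w]` is congruent modulo the Kontsevich–Zagier
relations to an element of the tame cubical span (indeed to the single tame class `[[0,1]ᵐ, H]`).
[cite: KontsevichZagier2001, §1.2 rules (1),(2)] [cite: HuberMullerStachPeriods2017, Lemma 12.2.2] -/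
theorem powerSubstToTame : ∀ (m N : ℕ) (w : IntegralRep m) (H : (Fin m → ℝ) → ℝ), 0 < N →
    w.domain = {x : Fin m → ℝ | ∀ i, 0 < x i ∧ x i < 1} →
    AnalyticOnNhd ℝ H {x : Fin m → ℝ | ∀ i, 0 ≤ x i ∧ x i ≤ 1} →
    (∀ x ∈ {x : Fin m → ℝ | ∀ i, 0 < x i ∧ x i < 1},
      H x = w.integrand (fun i => x i ^ N) * ∏ i, ((N : ℝ) * x i ^ (N - 1))) →
    ∃ c ∈ AddSubgroup.closure {d : FormalRep | ∃ (n : ℕ) (r : IntegralRep n),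
      r.domain = {x : Fin n → ℝ | ∀ i, 0 ≤ x i ∧ x i ≤ 1} ∧
      AnalyticOnNhd ℝ r.integrand {x : Fin n → ℝ | ∀ i, 0 ≤ x i ∧ x i ≤ 1} ∧ d = of r},
      of w - c ∈ relations := by
  classical
  intro m N w H hN hw hHa hH
  -- the power substitution in all coordinates
  obtain ⟨wU, hwUd, hwUi, hwU⟩ := exists_powerSubst N hN w hw Finset.univ
  have hwUH : ∀ x ∈ {x : Fin m → ℝ | ∀ i, 0 < x i ∧ x i < 1}, wU.integrand x = H x := by
    intro x hx
    rw [hwUi x hx, hH x hx]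
    simp
  -- `H` is semialgebraic on the closed cube by continuity
  have hHa' : AnalyticOnNhd ℝ H (KZ.cube m) := hHa
  have hHs : IsSemialgebraicFunOn ℚ (KZ.cube m) H := by
    have h0 : IsSemialgebraicFunOn ℚ {x : Fin m → ℝ | ∀ i, 0 < x i ∧ x i < 1} H :=
      (hwUd ▸ wU.isSemialgebraicFunOn_integrand).congr fun x hx => hwUH x hx
    exact stokesCal_isSemialgebraicFunOn_of_subset_closure h0 (fun x hx i => ⟨(hx i).1.le, (hx i).2.le⟩)
      (cube_subset_closure_openCube m) KZ.isCompact_cube hHa'.continuousOn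
  set r : IntegralRep m := IntegralRep.tameCube H hHa' hHs with hr
  have hwUr : of wU - of r ∈ relations := by
    refine of_sub_of_mem_relations_of_null wU r ?_ ?_ fun x hx => ?_
    · rw [hwUd, hr, IntegralRep.tameCube_domain,
        show {x : Fin m → ℝ | ∀ i, 0 < x i ∧ x i < 1} \ KZ.cube m = ∅ from
          Set.sdiff_eq_empty.2 fun x hx i => ⟨(hx i).1.le, (hx i).2.le⟩, measure_empty]
    · rw [hwUd, hr, IntegralRep.tameCube_domain]
      exact volume_cube_diff_openCube m
    · rw [hr, IntegralRep.tameCube_integrand]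
      rw [hwUd] at hx
      exact hwUH x hx.1
  refine ⟨of r, AddSubgroup.subset_closure ⟨m, r, rfl, hHa', rfl⟩, ?_⟩
  have : of w - of r = (of w - of wU) + (of wU - of r) := by abel
  rw [this]
  exact relations.add_mem hwU hwUr

end Summit.KontsevichZagierPeriods.FurushoPentagon.SectorToKernel
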